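import Summits.QuantumFields.YangMills.Theorems.WeakCouplingRatesCurrency
import Summits.QuantumFields.YangMills.Theorems.SourcedPressureJensenColdBoxSourcedPressureTorusFreeBridge
import Literature.MathematicalPhysics.QuantumFieldTheory.BalabanBlockSpecification
import Mathlib.MeasureTheory.Measure.Tilted
import HarnessLib

/-!
# `ColdBoxSourcedPressure` (KS1′, stmt-QuantumFields-23996), line «birth»: the OBJECTS of the free-cell statement and their
# identification with Sweep1's free-boundary cube

Definitions (the literal sub-expressions of the route decl `Theses.SourcedPressureJensen.ColdBoxSourcedPressure`, rev 7, named so that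
the registered stubs of `Cruxes/ColdBoxSourcedPressure/Lines/birth.lean` can be landed by name):

* `cellSource r β m ℓ n L` — the pair source `X = Σ_{pairs (x, x+ne₀) inside [0,ℓ]⁴} (βc_x − m)(βc_{x+ne₀} − m)` on the torus of side `L+1`;
* `outsideAction r ℓ L` — `S_out`, the Wilson cost of every plaquette of the torus NOT inside the cell `[0,ℓ]⁴`;
* `freeCellState r β ℓ L` — the torus Wilson state tilted by `+β·S_out` (the free-boundary cell inside the torus);
* `natSite x` — the integer site of a torus multi-index `x : Fin 4 → Fin (L+1)`.

Identification with the tree (Sweep1 / Chatterjee's free cube `B_{ℓ+1} = halfOpenBox 4 (ℓ+1)`):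

* `toTorusObservable_plaqCost0_configShift` — the route's torus plaquette cost term is `N − Re tr r(U_{x;ij})`;
* `wilsonAction_eq_sum_fin` — the torus action as the route-style triple sum over `x : Fin 4 → Fin (L+1)`, `i < j`;
* **`wilsonAction_sub_outsideAction`** — `S_T − S_out = S_{B_{ℓ+1}} ∘ torusLift (L+1)` (Sweep1's `zdWilsonAction` of the cube), `ℓ+1 ≤ L`;
* `torusEdge_injOn_cellBonds` — the periodisation is injective on the bonds of the cube's plaquettes, `ℓ+1 ≤ L`;
* **`integral_comp_torusLift_freeCellState`** — for every measurable `F` depending on those bonds,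
  `∫ F ∘ torusLift (L+1) d(freeCellState r β ℓ L) = zdExpect r.ρ β (halfOpenBox 4 (ℓ+1)) F`: free-cell expectations in the
  route's encoding ARE Chatterjee/Sweep1 free-cube expectations, independent of the ambient torus.

Everything is proved; the four definitions are the only new objects (route-posited, reviewed).  RECORD-label rung support; the
Yang–Mills mass gap is NOT proved by anything here.
-/

set_option autoImplicit false

noncomputable section

open MeasureTheory Finset
open Literature.Probability.LatticeModels Literature.MathematicalPhysics.QuantumLattice
open Literature.MathematicalPhysics.QuantumFieldTheory Literature.MathematicalPhysics.QuantumFieldTheory.AreaLaw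
open Summit.QuantumFields.YangMills.Theorems.WeakCouplingRates
open Summit.QuantumFields.YangMills.Theorems.SourcedPressureJensen

namespace Summit.QuantumFields.YangMills.Cruxes.ColdBoxSourcedPressure.Birth

variable {G : Type} [Group G] [TopologicalSpace G] [IsTopologicalGroup G] [CompactSpace G]
  [MeasurableSpace G] [BorelSpace G]

/-! ### The objects -/

/-- The SOURCE of KS1′: `X(U) = Σ_x [pair (x, x+ne₀) inside the cell [0,ℓ]⁴] (βc_x(U) − m)(βc_{x+ne₀}(U) − m)` on the torus of
side `L+1` (the literal sub-expression of `ColdBoxSourcedPressure`). -/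
def cellSource (r : LatticeRep G) (β m : ℝ) (ℓ n L : ℕ) (U : GaugeConfig 4 (L + 1) G) : ℝ :=
  ∑ x : Fin 4 → Fin (L + 1), if ((∀ k : Fin 4, ((x k : ℕ)) ≤ ℓ) ∧ ((x 1 : ℕ)) + 1 ≤ ℓ ∧ ((x 2 : ℕ)) + 1 ≤ ℓ ∧
      ((x 0 : ℕ)) + n ≤ ℓ) then toTorusObservable (L + 1) (fun V => (β * plaqCost0 (d := 4) r.ρ 1 2
        (configShift (fun k => -((x k : ℕ) : ℤ)) V) - m) * (β * plaqCost0 (d := 4) r.ρ 1 2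
          (timeShiftLG (G := G) n (configShift (fun k => -((x k : ℕ) : ℤ)) V)) - m)) U else 0

/-- The OUTSIDE ACTION of KS1′: `S_out(U) = Σ` of the Wilson costs of all plaquettes of the torus of side `L+1` that are NOT inside
the cell `[0,ℓ]⁴` (the literal sub-expression of `ColdBoxSourcedPressure`). -/
def outsideAction (r : LatticeRep G) (ℓ L : ℕ) (U : GaugeConfig 4 (L + 1) G) : ℝ :=
  ∑ x : Fin 4 → Fin (L + 1), ∑ i : Fin 4, ∑ j : Fin 4, if i < j ∧ ¬ ((∀ k : Fin 4, ((x k : ℕ)) ≤ ℓ) ∧ ((x i : ℕ)) + 1 ≤ ℓ ∧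
      ((x j : ℕ)) + 1 ≤ ℓ) then toTorusObservable (L + 1) (fun V => plaqCost0 (d := 4) r.ρ i j
        (configShift (fun k => -((x k : ℕ) : ℤ)) V)) U else 0

/-- The FREE-CELL STATE inside the torus: the torus Wilson state of side `L+1` tilted by `+β·S_out` — the outside plaquette
weights are removed, so this is (Haar on the outside links) × (free-boundary Wilson measure of the cell `[0,ℓ]⁴`). -/
def freeCellState (r : LatticeRep G) (β : ℝ) (ℓ L : ℕ) : Measure (GaugeConfig 4 (L + 1) G) :=
  (wilsonMeasure (d := 4) (L := L + 1) r.ρ β).tilted (fun U => β * outsideAction r ℓ L U)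

/-- The integer site `(x₀, x₁, x₂, x₃) ∈ ℤ⁴` of a torus multi-index `x : Fin 4 → Fin (L+1)` (the route shifts observables by
`configShift (−natSite x)`). -/
def natSite {L : ℕ} (x : Fin 4 → Fin (L + 1)) : Literature.Probability.LatticeModels.Site 4 := fun k => ((x k : ℕ) : ℤ)

/-! ### The torus plaquette cost term of the route -/

omit [TopologicalSpace G] [IsTopologicalGroup G] [CompactSpace G] [BorelSpace G] in
/-- The periodisation of `natSite x` is `x` itself (`ZMod (L+1) = Fin (L+1)`). -/
theorem torusProj_natSite {L : ℕ} (x : Fin 4 → Fin (L + 1)) :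
    Torus.proj (L + 1) (natSite x) = fun k => ((x k : ℕ) : ZMod (L + 1)) := by
  funext k
  simp [natSite]

omit [TopologicalSpace G] [IsTopologicalGroup G] [CompactSpace G] [BorelSpace G] in
/-- **The route's torus plaquette cost term**: for `x : Fin 4 → Fin (L+1)` and a plane `(i, j)`,
`(plaqCost0 ρ i j ∘ configShift (−natSite x))^{torus} U = N − Re tr ρ(U_{proj (natSite x); i j})`. -/
theorem toTorusObservable_plaqCost0_configShift {N : ℕ} (ρ : G →* Matrix (Fin N) (Fin N) ℂ) {L : ℕ}
    (x : Fin 4 → Fin (L + 1)) (i j : Fin 4) (U : GaugeConfig 4 (L + 1) G) :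
    toTorusObservable (L + 1) (fun V => plaqCost0 (d := 4) ρ i j (configShift (fun k => -((x k : ℕ) : ℤ)) V)) U =
      (N : ℝ) - (ρ (plaquetteHolonomy U (Torus.proj (L + 1) (natSite x)) i j)).trace.re := by
  have hshift : plaquetteHolonomyZd (configShift (fun k => -((x k : ℕ) : ℤ)) (torusLift (L + 1) U)) 0 i j =
      plaquetteHolonomyZd (torusLift (L + 1) U) (natSite x) i j := by
    simp only [plaquetteHolonomyZd, Literature.MathematicalPhysics.QuantumLattice.configShift_apply]
    have e0 : (0 : Literature.Probability.LatticeModels.Site 4) - (fun k => -((x k : ℕ) : ℤ)) = natSite x := by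
      funext k; simp [natSite]
    have e1 : ∀ a : Fin 4, (0 : Literature.Probability.LatticeModels.Site 4) + Pi.single a (1 : ℤ) - (fun k => -((x k : ℕ) : ℤ)) =
        natSite x + Pi.single a 1 := by
      intro a; funext k; simp [natSite]; ring
    rw [e0, e1, e1]
  have hper : plaquetteHolonomyZd (torusLift (L + 1) U) (natSite x) i j =
      plaquetteHolonomy U (Torus.proj (L + 1) (natSite x)) i j :=
    plaquette_torusLift (L + 1) U (natSite x) i j
  simp only [toTorusObservable_apply, plaqCost0, plaquetteObs]
  rw [hshift, hper]

/-! ### Injectivity of the periodisation on the cell -/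

omit [TopologicalSpace G] [IsTopologicalGroup G] [CompactSpace G] [BorelSpace G] in
/-- `Torus.proj (L+1)` is injective on the cube `B_{ℓ+1} = {0,…,ℓ}⁴` when `ℓ + 1 ≤ L`. -/
theorem torusProj_injOn_halfOpenBox {ℓ L : ℕ} (hL : ℓ + 1 ≤ L) :
    Set.InjOn (Torus.proj (d := 4) (L + 1)) (halfOpenBox 4 (ℓ + 1) : Set (Literature.Probability.LatticeModels.Site 4)) := by
  intro x hx y hy hxy
  funext k
  have hk : ((x k : ℤ) : ZMod (L + 1)) = ((y k : ℤ) : ZMod (L + 1)) := congrFun hxy k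
  rw [ZMod.intCast_eq_intCast_iff_dvd_sub] at hk
  obtain ⟨hx1, hx2⟩ := mem_halfOpenBox.1 (Finset.mem_coe.1 hx) k
  obtain ⟨hy1, hy2⟩ := mem_halfOpenBox.1 (Finset.mem_coe.1 hy) k
  have hL' : ((ℓ + 1 : ℕ) : ℤ) ≤ L := by exact_mod_cast hL
  have hlt : |y k - x k| < ((L + 1 : ℕ) : ℤ) := by
    rw [abs_lt]; push_cast at hx2 hy2 hL' ⊢; constructor <;> linarith
  have h0 := Int.eq_zero_of_abs_lt_dvd hk hlt
  linarith

omit [TopologicalSpace G] [IsTopologicalGroup G] [CompactSpace G] [BorelSpace G] in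
/-- Every bond of a plaquette of the cube `B_{ℓ+1}` is based at a site of the cube. -/
theorem fst_mem_halfOpenBox_of_mem_cellBonds {ℓ : ℕ} {e : Literature.MathematicalPhysics.QuantumLattice.ZdEdge 4}
    (he : e ∈ (plaquettesIn (halfOpenBox 4 (ℓ + 1))).biUnion Plaq.bonds) : e.1 ∈ halfOpenBox 4 (ℓ + 1) := by
  obtain ⟨p, hp, hep⟩ := Finset.mem_biUnion.1 he
  obtain ⟨h1, -, h2, h3, -⟩ := Plaq.mem_plaquettesIn.1 hp
  simp only [Plaq.bonds, Finset.mem_insert, Finset.mem_singleton] at hep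
  rcases hep with rfl | rfl | rfl | rfl
  · exact h1
  · exact h2
  · exact h3
  · exact h1

omit [TopologicalSpace G] [IsTopologicalGroup G] [CompactSpace G] [BorelSpace G] in
/-- **The periodisation `torusEdge (L+1)` is injective on the bonds of the plaquettes of the cube `B_{ℓ+1}`** (`ℓ + 1 ≤ L`). -/
theorem torusEdge_injOn_cellBonds {ℓ L : ℕ} (hL : ℓ + 1 ≤ L) :
    Set.InjOn (torusEdge (d := 4) (L + 1))
      (((plaquettesIn (halfOpenBox 4 (ℓ + 1))).biUnion Plaq.bonds :
        Finset (Literature.MathematicalPhysics.QuantumLattice.ZdEdge 4)) : Set (Literature.MathematicalPhysics.QuantumLattice.ZdEdge 4)) := by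
  intro e he e' he' hee'
  simp only [torusEdge, Prod.mk.injEq] at hee'
  exact Prod.ext (torusProj_injOn_halfOpenBox hL (Finset.mem_coe.2 (fst_mem_halfOpenBox_of_mem_cellBonds (Finset.mem_coe.1 he)))
    (Finset.mem_coe.2 (fst_mem_halfOpenBox_of_mem_cellBonds (Finset.mem_coe.1 he'))) hee'.1) hee'.2

/-! ### The torus action as a route-style triple sum, and its inside/outside split -/

omit [TopologicalSpace G] [IsTopologicalGroup G] [CompactSpace G] [BorelSpace G] in
/-- Sums over torus sites `Fin 4 → ZMod (L+1)` are sums over `x : Fin 4 → Fin (L+1)` through `proj ∘ natSite` (which is the identity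
of `Fin (L+1) = ZMod (L+1)`). -/
theorem sum_torusSite_eq_sum_natSite {L : ℕ} (h : TorusSite 4 (L + 1) → ℝ) :
    ∑ y : TorusSite 4 (L + 1), h y = ∑ x : Fin 4 → Fin (L + 1), h (Torus.proj (L + 1) (natSite x)) := by
  have key : ∀ x : Fin 4 → Fin (L + 1), Torus.proj (L + 1) (natSite x) = fun k => (x k : ZMod (L + 1)) := by
    intro x; funext k
    simp only [Torus.proj_apply, natSite, Int.cast_natCast]
    exact ZMod.natCast_zmod_val (n := L + 1) (x k)
  simp_rw [key]
  rfl

omit [TopologicalSpace G] [IsTopologicalGroup G] [CompactSpace G] [MeasurableSpace G] [BorelSpace G] in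
/-- **The torus Wilson action as the route-style triple sum**:
`S_T(U) = Σ_{x : Fin 4 → Fin (L+1)} Σ_{i<j} (N − Re tr ρ(U_{proj (natSite x); i j}))`. -/
theorem wilsonAction_eq_sum_fin {N : ℕ} (ρ : G →* Matrix (Fin N) (Fin N) ℂ) {L : ℕ} (U : GaugeConfig 4 (L + 1) G) :
    wilsonAction ρ U = ∑ x : Fin 4 → Fin (L + 1), ∑ i : Fin 4, ∑ j : Fin 4,
      if i < j then (N : ℝ) - (ρ (plaquetteHolonomy U (Torus.proj (L + 1) (natSite x)) i j)).trace.re else 0 := by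
  unfold wilsonAction
  rw [Fintype.sum_prod_type]
  rw [sum_torusSite_eq_sum_natSite (fun y => ∑ q : {p : Fin 4 × Fin 4 // p.1 < p.2},
    ((N : ℝ) - (ρ (plaquetteHolonomy U y q.1.1 q.1.2)).trace.re))]
  refine Finset.sum_congr rfl fun x _ => ?_
  -- planes `{(i,j) // i < j}` as a double sum with an indicator (inlined; cf. `TunedSequenceExists.UniformFreezing.sum_planes_eq`)
  classical
  rw [← Finset.sum_subtype (Finset.univ.filter fun p : Fin 4 × Fin 4 => p.1 < p.2) (by simp)
      (fun p : Fin 4 × Fin 4 => (N : ℝ) - (ρ (plaquetteHolonomy U (Torus.proj (L + 1) (natSite x)) p.1 p.2)).trace.re),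
    Finset.sum_filter, ← Finset.univ_product_univ, Finset.sum_product]

omit [TopologicalSpace G] [IsTopologicalGroup G] [CompactSpace G] [BorelSpace G] in
/-- Membership of the route's "inside" plaquettes in Sweep1's `plaquettesIn (halfOpenBox 4 (ℓ+1))`. -/
theorem natSite_mem_plaquettesIn_iff {L ℓ : ℕ} (x : Fin 4 → Fin (L + 1)) (i j : Fin 4) :
    ((natSite x, i, j) : Plaq 4) ∈ plaquettesIn (halfOpenBox 4 (ℓ + 1)) ↔
      i < j ∧ ((∀ k : Fin 4, ((x k : ℕ)) ≤ ℓ) ∧ ((x i : ℕ)) + 1 ≤ ℓ ∧ ((x j : ℕ)) + 1 ≤ ℓ) := by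
  rw [Plaq.mem_plaquettesIn]
  simp only [mem_halfOpenBox, natSite, Pi.add_apply]
  constructor
  · rintro ⟨h1, hij, h2, h3, -⟩
    refine ⟨hij, fun k => ?_, ?_, ?_⟩
    · have := (h1 k).2; omega
    · have := (h2 i).2; simp only [Pi.single_eq_same] at this; omega
    · have := (h3 j).2; simp only [Pi.single_eq_same] at this; omega
  · rintro ⟨hij, h1, h2, h3⟩
    have hne : i ≠ j := ne_of_lt hij
    refine ⟨fun k => ⟨by positivity, by have := h1 k; omega⟩, hij, fun k => ?_, fun k => ?_, fun k => ?_⟩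
    · by_cases hk : k = i
      · subst hk; simp only [Pi.single_eq_same]; constructor <;> omega
      · simp only [Pi.single_eq_of_ne hk]; have := h1 k; constructor <;> omega
    · by_cases hk : k = j
      · subst hk; simp only [Pi.single_eq_same]; constructor <;> omega
      · simp only [Pi.single_eq_of_ne hk]; have := h1 k; constructor <;> omega
    · by_cases hki : k = i
      · subst hki; simp only [Pi.single_eq_same, Pi.single_eq_of_ne hne]; constructor <;> omega
      · by_cases hkj : k = j
        · subst hkj; simp only [Pi.single_eq_same, Pi.single_eq_of_ne hki]; constructor <;> omega
        · simp only [Pi.single_eq_of_ne hki, Pi.single_eq_of_ne hkj]; have := h1 k; constructor <;> omega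

omit [TopologicalSpace G] [IsTopologicalGroup G] [CompactSpace G] [MeasurableSpace G] [BorelSpace G] in
/-- **The inside part of the triple sum is Sweep1's cube action of the periodic lift.**  For `ℓ + 1 ≤ L`,
`Σ_{x} Σ_{i<j, (x;i,j) inside [0,ℓ]⁴} (N − Re tr ρ(U_{proj (natSite x); ij})) = zdWilsonAction ρ (halfOpenBox 4 (ℓ+1)) (torusLift (L+1) U)`. -/
theorem sum_inside_eq_zdWilsonAction_torusLift {N : ℕ} (ρ : G →* Matrix (Fin N) (Fin N) ℂ) {ℓ L : ℕ} (hL : ℓ + 1 ≤ L)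
    (U : GaugeConfig 4 (L + 1) G) :
    (∑ x : Fin 4 → Fin (L + 1), ∑ i : Fin 4, ∑ j : Fin 4,
      if i < j ∧ ((∀ k : Fin 4, ((x k : ℕ)) ≤ ℓ) ∧ ((x i : ℕ)) + 1 ≤ ℓ ∧ ((x j : ℕ)) + 1 ≤ ℓ) then
        (N : ℝ) - (ρ (plaquetteHolonomy U (Torus.proj (L + 1) (natSite x)) i j)).trace.re else 0) =
      zdWilsonAction ρ (halfOpenBox 4 (ℓ + 1)) (torusLift (L + 1) U) := by
  classical
  rw [zdWilsonAction_torusLift]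
  -- flatten the triple sum to a sum over the filtered finset of triples
  have hflat : (∑ x : Fin 4 → Fin (L + 1), ∑ i : Fin 4, ∑ j : Fin 4,
      if i < j ∧ ((∀ k : Fin 4, ((x k : ℕ)) ≤ ℓ) ∧ ((x i : ℕ)) + 1 ≤ ℓ ∧ ((x j : ℕ)) + 1 ≤ ℓ) then
        (N : ℝ) - (ρ (plaquetteHolonomy U (Torus.proj (L + 1) (natSite x)) i j)).trace.re else 0) =
      ∑ t ∈ (Finset.univ : Finset ((Fin 4 → Fin (L + 1)) × Fin 4 × Fin 4)).filter (fun t =>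
        t.2.1 < t.2.2 ∧ ((∀ k : Fin 4, ((t.1 k : ℕ)) ≤ ℓ) ∧ ((t.1 t.2.1 : ℕ)) + 1 ≤ ℓ ∧ ((t.1 t.2.2 : ℕ)) + 1 ≤ ℓ)),
        ((N : ℝ) - (ρ (plaquetteHolonomy U (Torus.proj (L + 1) (natSite t.1)) t.2.1 t.2.2)).trace.re) := by
    symm
    rw [Finset.sum_filter, Fintype.sum_prod_type]
    refine Finset.sum_congr rfl fun x _ => ?_
    rw [Fintype.sum_prod_type]
  rw [hflat]
  -- the bijection `t ↦ (natSite t.1, t.2.1, t.2.2)` onto `plaquettesIn (halfOpenBox 4 (ℓ+1))`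
  refine Finset.sum_bij' (fun t _ => ((natSite t.1, t.2.1, t.2.2) : Plaq 4))
    (fun p _ => (fun k => (⟨(p.1 k).toNat % (L + 1), Nat.mod_lt _ (Nat.succ_pos L)⟩ : Fin (L + 1)), p.2.1, p.2.2))
    ?_ ?_ ?_ ?_ ?_
  · intro t ht
    exact (natSite_mem_plaquettesIn_iff t.1 t.2.1 t.2.2).2 (Finset.mem_filter.1 ht).2
  · intro p hp
    obtain ⟨h1, hij, h2, h3, -⟩ := Plaq.mem_plaquettesIn.1 hp
    rw [Finset.mem_filter]
    refine ⟨Finset.mem_univ _, hij, fun k => ?_, ?_, ?_⟩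
    · have hk := (mem_halfOpenBox.1 h1 k)
      have : (p.1 k).toNat ≤ ℓ := by omega
      exact (Nat.mod_le _ _).trans this
    · have hk := (mem_halfOpenBox.1 h2 p.2.1)
      simp only [Pi.add_apply, Pi.single_eq_same] at hk
      have h0 := (mem_halfOpenBox.1 h1 p.2.1).1
      have : (p.1 p.2.1).toNat + 1 ≤ ℓ := by omega
      have hlt : (p.1 p.2.1).toNat < L + 1 := by omega
      show (p.1 p.2.1).toNat % (L + 1) + 1 ≤ ℓ
      rw [Nat.mod_eq_of_lt hlt]; exact this
    · have hk := (mem_halfOpenBox.1 h3 p.2.2)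
      simp only [Pi.add_apply, Pi.single_eq_same] at hk
      have h0 := (mem_halfOpenBox.1 h1 p.2.2).1
      have : (p.1 p.2.2).toNat + 1 ≤ ℓ := by omega
      have hlt : (p.1 p.2.2).toNat < L + 1 := by omega
      show (p.1 p.2.2).toNat % (L + 1) + 1 ≤ ℓ
      rw [Nat.mod_eq_of_lt hlt]; exact this
  · intro t _
    refine Prod.ext ?_ rfl
    funext k
    apply Fin.ext
    simp only [natSite, Int.toNat_natCast]
    exact Nat.mod_eq_of_lt (t.1 k).isLt
  · intro p hp
    obtain ⟨h1, -, -, -, -⟩ := Plaq.mem_plaquettesIn.1 hp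
    refine Prod.ext ?_ rfl
    funext k
    have hk := mem_halfOpenBox.1 h1 k
    have hlt : (p.1 k).toNat < L + 1 := by omega
    show (((p.1 k).toNat % (L + 1) : ℕ) : ℤ) = p.1 k
    rw [Nat.mod_eq_of_lt hlt]
    omega
  · intro t _
    rfl

omit [IsTopologicalGroup G] [CompactSpace G] [BorelSpace G] in
/-- **`S_T − S_out = S_{B_{ℓ+1}} ∘ torusLift`**: removing the outside action from the torus Wilson action leaves exactly Sweep1's
free-boundary action of the cube `halfOpenBox 4 (ℓ+1) = [0,ℓ]⁴` read on the periodic lift (`ℓ + 1 ≤ L`). -/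
theorem wilsonAction_sub_outsideAction (r : LatticeRep G) {ℓ L : ℕ} (hL : ℓ + 1 ≤ L) (U : GaugeConfig 4 (L + 1) G) :
    wilsonAction r.ρ U - outsideAction r ℓ L U = zdWilsonAction r.ρ (halfOpenBox 4 (ℓ + 1)) (torusLift (L + 1) U) := by
  rw [← sum_inside_eq_zdWilsonAction_torusLift r.ρ hL U, wilsonAction_eq_sum_fin, outsideAction]
  simp_rw [toTorusObservable_plaqCost0_configShift]
  rw [← Finset.sum_sub_distrib]
  refine Finset.sum_congr rfl fun x _ => ?_
  rw [← Finset.sum_sub_distrib]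
  refine Finset.sum_congr rfl fun i _ => ?_
  rw [← Finset.sum_sub_distrib]
  refine Finset.sum_congr rfl fun j _ => ?_
  by_cases hij : i < j
  · by_cases hin : ((∀ k : Fin 4, ((x k : ℕ)) ≤ ℓ) ∧ ((x i : ℕ)) + 1 ≤ ℓ ∧ ((x j : ℕ)) + 1 ≤ ℓ)
    · rw [if_pos hij, if_neg (fun h => h.2 hin), if_pos ⟨hij, hin⟩]
      ring
    · rw [if_pos hij, if_pos ⟨hij, hin⟩, if_neg (fun h => hin h.2)]
      ring
  · rw [if_neg hij, if_neg (fun h => hij h.1), if_neg (fun h => hij h.1)]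
    ring

/-! ### Basic API of the free-cell state -/

omit [BorelSpace G] in
/-- The source is continuous. -/
theorem continuous_cellSource (r : LatticeRep G) (β m : ℝ) (ℓ n L : ℕ) : Continuous (cellSource r β m ℓ n L) := by
  unfold cellSource
  refine continuous_finsetSum _ fun x _ => ?_
  split_ifs
  · have hc := (continuous_bounded_plaqCost0 (d := 4) r.ρ r.continuous 1 2).1
    have hs : Continuous (configShift (d := 4) (G := G) (fun k => -((x k : ℕ) : ℤ))) :=
      continuous_pi fun e => by simp only [Literature.MathematicalPhysics.QuantumLattice.configShift_apply]; exact continuous_apply _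
    exact ((((continuous_const.mul (hc.comp hs)).sub continuous_const).mul
      ((continuous_const.mul (hc.comp ((continuous_timeShiftLG n).comp hs))).sub continuous_const))).comp
        (continuous_torusLift (L + 1))
  · exact continuous_const

omit [BorelSpace G] in
/-- The outside action is continuous. -/
theorem continuous_outsideAction (r : LatticeRep G) (ℓ L : ℕ) : Continuous (outsideAction r ℓ L) := by
  unfold outsideAction
  refine continuous_finsetSum _ fun x _ => continuous_finsetSum _ fun i _ => continuous_finsetSum _ fun j _ => ?_
  split_ifs
  · have hc := (continuous_bounded_plaqCost0 (d := 4) r.ρ r.continuous i j).1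
    have hs : Continuous (configShift (d := 4) (G := G) (fun k => -((x k : ℕ) : ℤ))) :=
      continuous_pi fun e => by simp only [Literature.MathematicalPhysics.QuantumLattice.configShift_apply]; exact continuous_apply _
    exact (hc.comp hs).comp (continuous_torusLift (L + 1))
  · exact continuous_const

omit [Group G] [IsTopologicalGroup G] [MeasurableSpace G] [BorelSpace G] in
/-- A continuous real function on the (compact) torus configuration space is bounded. -/
theorem exists_abs_le_of_continuous {L : ℕ} {f : GaugeConfig 4 L G → ℝ} (hf : Continuous f) :
    ∃ K : ℝ, ∀ U, |f U| ≤ K := by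
  obtain ⟨K, hK⟩ := (isCompact_range hf).isBounded.subset_closedBall 0
  exact ⟨K, fun U => by simpa [Metric.mem_closedBall, Real.dist_eq] using hK (Set.mem_range_self U)⟩

/-- The free-cell state is a probability measure. -/
theorem isProbabilityMeasure_freeCellState (r : LatticeRep G) (β : ℝ) (ℓ L : ℕ) :
    IsProbabilityMeasure (freeCellState r β ℓ L) := by
  haveI := r.secondCountableTopology
  haveI := isProbabilityMeasure_wilsonMeasure (d := 4) (L := L + 1) (G := G) r.ρ r.continuous β
  refine isProbabilityMeasure_tilted ?_
  exact (Real.continuous_exp.comp (continuous_const.mul (continuous_outsideAction r ℓ L))).integrable_of_hasCompactSupport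
    (HasCompactSupport.of_compactSpace _)

/-- **The ratio of torus expectations in `ColdBoxSourcedPressure` is the free-cell expectation**:
`E_T[F · e^{βS_out}] / E_T[e^{βS_out}] = ∫ F dν`, `ν = freeCellState`. -/
theorem ratio_eq_integral_freeCellState (r : LatticeRep G) (β : ℝ) (ℓ L : ℕ) (F : GaugeConfig 4 (L + 1) G → ℝ) :
    wilsonExpectation (L := L + 1) r.ρ β (fun U => F U * Real.exp (β * outsideAction r ℓ L U)) /
        wilsonExpectation (L := L + 1) r.ρ β (fun U => Real.exp (β * outsideAction r ℓ L U)) =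
      ∫ U, F U ∂(freeCellState r β ℓ L) :=
  wilsonExpectation_mul_exp_div_eq_integral_tilted r.ρ β _ F

/-! ### The bridge for the free-cell state -/

/-- **Free-cell expectations in the route's encoding ARE Sweep1/Chatterjee free-cube expectations.**  For `ℓ + 1 ≤ L` and every
measurable `F : G^{E(ℤ⁴)} → ℝ` depending only on the bonds of the plaquettes of the cube `B_{ℓ+1} = halfOpenBox 4 (ℓ+1) = [0,ℓ]⁴`,
`∫ F (torusLift (L+1) U) d(freeCellState r β ℓ L)(U) = zdExpect r.ρ β (halfOpenBox 4 (ℓ+1)) F` — in particular the left side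
does not depend on the ambient torus `L`. -/
theorem integral_comp_torusLift_freeCellState (r : LatticeRep G) (β : ℝ) {ℓ L : ℕ} (hL : ℓ + 1 ≤ L)
    {F : ZdGaugeConfig 4 G → ℝ} (hFm : Measurable F)
    (hdep : DependsOn F (((plaquettesIn (halfOpenBox 4 (ℓ + 1))).biUnion Plaq.bonds :
      Finset (Literature.MathematicalPhysics.QuantumLattice.ZdEdge 4)) : Set (Literature.MathematicalPhysics.QuantumLattice.ZdEdge 4))) :
    ∫ U, F (torusLift (L + 1) U) ∂(freeCellState r β ℓ L) = zdExpect r.ρ β (halfOpenBox 4 (ℓ + 1)) F := by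
  haveI := r.secondCountableTopology
  refine integral_comp_torusLift_tilted_eq_zdExpect r.ρ r.continuous β (halfOpenBox 4 (ℓ + 1)) (outsideAction r ℓ L)
    (fun U => ?_) (torusEdge_injOn_cellBonds hL) hFm hdep
  rw [← wilsonAction_sub_outsideAction r hL U]
  ring

/-- The same in the route's ratio form: `E_T[(F ∘ torusLift) e^{βS_out}] / E_T[e^{βS_out}] = zdExpect r.ρ β B_{ℓ+1} F`. -/
theorem ratio_eq_zdExpect (r : LatticeRep G) (β : ℝ) {ℓ L : ℕ} (hL : ℓ + 1 ≤ L)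
    {F : ZdGaugeConfig 4 G → ℝ} (hFm : Measurable F)
    (hdep : DependsOn F (((plaquettesIn (halfOpenBox 4 (ℓ + 1))).biUnion Plaq.bonds :
      Finset (Literature.MathematicalPhysics.QuantumLattice.ZdEdge 4)) : Set (Literature.MathematicalPhysics.QuantumLattice.ZdEdge 4))) :
    wilsonExpectation (L := L + 1) r.ρ β (fun U => F (torusLift (L + 1) U) * Real.exp (β * outsideAction r ℓ L U)) /
        wilsonExpectation (L := L + 1) r.ρ β (fun U => Real.exp (β * outsideAction r ℓ L U)) =
      zdExpect r.ρ β (halfOpenBox 4 (ℓ + 1)) F := by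
  rw [ratio_eq_integral_freeCellState]
  exact integral_comp_torusLift_freeCellState r β hL hFm hdep

/-! ### The source as a `ℤ⁴` cylinder observable -/

/-- The base sites of the pairs `(z, z + ne₀)` inside the cell: `z ∈ [0,ℓ]⁴` with `z₁+1 ≤ ℓ`, `z₂+1 ≤ ℓ`, `z₀+n ≤ ℓ`. -/
def cellPairSites (ℓ n : ℕ) : Finset (Literature.Probability.LatticeModels.Site 4) :=
  (halfOpenBox 4 (ℓ + 1)).filter fun z => z 1 + 1 ≤ (ℓ : ℤ) ∧ z 2 + 1 ≤ (ℓ : ℤ) ∧ z 0 + (n : ℤ) ≤ (ℓ : ℤ)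

/-- The pair density at `z ∈ ℤ⁴`: `(βc_z − m)(βc_{z+ne₀} − m)` on `ℤ⁴` configurations (the route's integrand, read at the integer site). -/
def pairDensity (r : LatticeRep G) (β m : ℝ) (n : ℕ) (z : Literature.Probability.LatticeModels.Site 4) (V : LGConfig 4 G) : ℝ :=
  (β * plaqCost0 (d := 4) r.ρ 1 2 (configShift (-z) V) - m) *
    (β * plaqCost0 (d := 4) r.ρ 1 2 (timeShiftLG (G := G) n (configShift (-z) V)) - m)

/-- The source as a `ℤ⁴` cylinder observable: `X^{ℤ}(V) = Σ_{z ∈ cellPairSites ℓ n} (βc_z − m)(βc_{z+ne₀} − m)` (no ambient torus). -/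
def cellSourceZd (r : LatticeRep G) (β m : ℝ) (ℓ n : ℕ) (V : LGConfig 4 G) : ℝ :=
  ∑ z ∈ cellPairSites ℓ n, pairDensity r β m n z V

omit [TopologicalSpace G] [IsTopologicalGroup G] [CompactSpace G] [BorelSpace G] in
/-- Plaquette holonomies of a shifted configuration (`(θ_v W)_{x} = W_{x−v}`). -/
theorem plaquetteHolonomyZd_configShift' (v : Literature.Probability.LatticeModels.Site 4) (W : LGConfig 4 G)
    (x : Literature.Probability.LatticeModels.Site 4) (i j : Fin 4) :
    plaquetteHolonomyZd (configShift v W) x i j = plaquetteHolonomyZd W (x - v) i j := by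
  simp only [plaquetteHolonomyZd, Literature.MathematicalPhysics.QuantumLattice.configShift_apply, add_sub_right_comm]

omit [IsTopologicalGroup G] [CompactSpace G] [BorelSpace G] in
/-- The shifted origin plaquette cost is the cost of the plaquette at `z`: `c(θ_{−z}V)_{0;ij} = N − Re tr ρ(V_{z;ij})`. -/
theorem plaqCost0_configShift_neg (r : LatticeRep G) (i j : Fin 4) (z : Literature.Probability.LatticeModels.Site 4) (V : LGConfig 4 G) :
    plaqCost0 (d := 4) r.ρ i j (configShift (-z) V) = (r.N : ℝ) - (r.ρ (plaquetteHolonomyZd V z i j)).trace.re := by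
  simp only [plaqCost0, plaquetteObs, plaquetteHolonomyZd_configShift', sub_neg_eq_add, zero_add]

omit [IsTopologicalGroup G] [CompactSpace G] [BorelSpace G] in
/-- The time-shifted, shifted origin plaquette cost is the cost of the plaquette at `z + ne₀`. -/
theorem plaqCost0_timeShiftLG_configShift_neg (r : LatticeRep G) (i j : Fin 4) (n : ℕ)
    (z : Literature.Probability.LatticeModels.Site 4) (V : LGConfig 4 G) :
    plaqCost0 (d := 4) r.ρ i j (timeShiftLG (G := G) n (configShift (-z) V)) =
      (r.N : ℝ) - (r.ρ (plaquetteHolonomyZd V (z + Pi.single 0 (n : ℤ)) i j)).trace.re := by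
  simp only [plaqCost0, plaquetteObs, timeShiftLG, plaquetteHolonomyZd_configShift', sub_neg_eq_add, zero_add]
  rw [add_comm]

omit [TopologicalSpace G] [IsTopologicalGroup G] [CompactSpace G] [MeasurableSpace G] [BorelSpace G] in
/-- A plaquette holonomy is determined by the configuration on the plaquette's four bonds. -/
theorem plaquetteHolonomyZd_congr_of_bonds {U V : LGConfig 4 G} (x : Literature.Probability.LatticeModels.Site 4) (i j : Fin 4)
    (h : ∀ e ∈ (Plaq.bonds ((x, i, j) : Plaq 4) : Finset (Literature.MathematicalPhysics.QuantumLattice.ZdEdge 4)), U e = V e) :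
    plaquetteHolonomyZd U x i j = plaquetteHolonomyZd V x i j := by
  unfold plaquetteHolonomyZd
  rw [h (x, i) (by simp [Plaq.bonds]), h (x + Pi.single i 1, j) (by simp [Plaq.bonds]),
    h (x + Pi.single j 1, i) (by simp [Plaq.bonds]), h (x, j) (by simp [Plaq.bonds])]

omit [IsTopologicalGroup G] [CompactSpace G] [BorelSpace G] in
/-- The pair density at `z` depends only on the bonds of the plaquettes `(z;1,2)` and `(z+ne₀;1,2)`. -/
theorem dependsOn_pairDensity (r : LatticeRep G) (β m : ℝ) (n : ℕ) (z : Literature.Probability.LatticeModels.Site 4) :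
    DependsOn (pairDensity r β m n z)
      (((Plaq.bonds ((z, 1, 2) : Plaq 4) ∪ Plaq.bonds ((z + Pi.single 0 (n : ℤ), 1, 2) : Plaq 4) :
        Finset (Literature.MathematicalPhysics.QuantumLattice.ZdEdge 4)) : Set (Literature.MathematicalPhysics.QuantumLattice.ZdEdge 4))) := by
  intro U V hUV
  have h1 : plaquetteHolonomyZd U z 1 2 = plaquetteHolonomyZd V z 1 2 :=
    plaquetteHolonomyZd_congr_of_bonds z 1 2 fun e he => hUV e (Finset.mem_coe.2 (Finset.mem_union_left _ he))
  have h2 : plaquetteHolonomyZd U (z + Pi.single 0 (n : ℤ)) 1 2 = plaquetteHolonomyZd V (z + Pi.single 0 (n : ℤ)) 1 2 :=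
    plaquetteHolonomyZd_congr_of_bonds _ 1 2 fun e he => hUV e (Finset.mem_coe.2 (Finset.mem_union_right _ he))
  have hA : plaqCost0 (d := 4) r.ρ 1 2 (configShift (-z) U) = plaqCost0 (d := 4) r.ρ 1 2 (configShift (-z) V) := by
    rw [plaqCost0_configShift_neg r 1 2 z U, plaqCost0_configShift_neg r 1 2 z V, h1]
  have hB : plaqCost0 (d := 4) r.ρ 1 2 (timeShiftLG (G := G) n (configShift (-z) U)) =
      plaqCost0 (d := 4) r.ρ 1 2 (timeShiftLG (G := G) n (configShift (-z) V)) := by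
    rw [plaqCost0_timeShiftLG_configShift_neg r 1 2 n z U, plaqCost0_timeShiftLG_configShift_neg r 1 2 n z V, h2]
  show (β * plaqCost0 (d := 4) r.ρ 1 2 (configShift (-z) U) - m) *
      (β * plaqCost0 (d := 4) r.ρ 1 2 (timeShiftLG (G := G) n (configShift (-z) U)) - m) =
    (β * plaqCost0 (d := 4) r.ρ 1 2 (configShift (-z) V) - m) *
      (β * plaqCost0 (d := 4) r.ρ 1 2 (timeShiftLG (G := G) n (configShift (-z) V)) - m)
  rw [hA, hB]

omit [TopologicalSpace G] [IsTopologicalGroup G] [CompactSpace G] [MeasurableSpace G] [BorelSpace G] in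
/-- Both plaquettes of a pair inside the cell are plaquettes of the cube `B_{ℓ+1}`. -/
theorem pair_mem_plaquettesIn {ℓ n : ℕ} {z : Literature.Probability.LatticeModels.Site 4} (hz : z ∈ cellPairSites ℓ n) :
    ((z, 1, 2) : Plaq 4) ∈ plaquettesIn (halfOpenBox 4 (ℓ + 1)) ∧
      ((z + Pi.single 0 (n : ℤ), 1, 2) : Plaq 4) ∈ plaquettesIn (halfOpenBox 4 (ℓ + 1)) := by
  rw [cellPairSites, Finset.mem_filter, mem_halfOpenBox] at hz
  obtain ⟨h0, h1, h2, h3⟩ := hz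
  have h00 := h0 0; have h01 := h0 1; have h02 := h0 2; have h03 := h0 3
  constructor
  · rw [Plaq.mem_plaquettesIn]
    refine ⟨mem_halfOpenBox.2 h0, show (1 : Fin 4) < 2 by decide, ?_, ?_, ?_⟩ <;> rw [mem_halfOpenBox] <;> intro k <;>
      fin_cases k <;> simp [Pi.add_apply] <;> omega
  · rw [Plaq.mem_plaquettesIn]
    refine ⟨?_, show (1 : Fin 4) < 2 by decide, ?_, ?_, ?_⟩ <;> rw [mem_halfOpenBox] <;> intro k <;>
      fin_cases k <;> simp [Pi.add_apply] <;> omega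

omit [IsTopologicalGroup G] [CompactSpace G] [BorelSpace G] in
/-- **The source depends only on the bonds of the cube's plaquettes.** -/
theorem dependsOn_cellSourceZd (r : LatticeRep G) (β m : ℝ) (ℓ n : ℕ) :
    DependsOn (cellSourceZd r β m ℓ n) (((plaquettesIn (halfOpenBox 4 (ℓ + 1))).biUnion Plaq.bonds :
      Finset (Literature.MathematicalPhysics.QuantumLattice.ZdEdge 4)) : Set (Literature.MathematicalPhysics.QuantumLattice.ZdEdge 4)) := by
  intro U V h
  unfold cellSourceZd
  refine Finset.sum_congr rfl fun z hz => ?_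
  obtain ⟨hp1, hp2⟩ := pair_mem_plaquettesIn hz
  refine dependsOn_pairDensity r β m n z fun e he => h e (Finset.mem_coe.2 ?_)
  rcases Finset.mem_union.1 (Finset.mem_coe.1 he) with he | he
  · exact Finset.mem_biUnion.2 ⟨_, hp1, he⟩
  · exact Finset.mem_biUnion.2 ⟨_, hp2, he⟩

omit [BorelSpace G] in
/-- The source on `ℤ⁴` is continuous. -/
theorem continuous_cellSourceZd (r : LatticeRep G) (β m : ℝ) (ℓ n : ℕ) : Continuous (cellSourceZd r β m ℓ n) := by
  unfold cellSourceZd pairDensity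
  refine continuous_finsetSum _ fun z _ => ?_
  have hc := (continuous_bounded_plaqCost0 (d := 4) r.ρ r.continuous 1 2).1
  have hs : Continuous (configShift (d := 4) (G := G) (-z)) :=
    continuous_pi fun e => by simp only [Literature.MathematicalPhysics.QuantumLattice.configShift_apply]; exact continuous_apply _
  exact ((continuous_const.mul (hc.comp hs)).sub continuous_const).mul
    ((continuous_const.mul (hc.comp ((continuous_timeShiftLG n).comp hs))).sub continuous_const)

omit [TopologicalSpace G] [IsTopologicalGroup G] [CompactSpace G] [BorelSpace G] in
/-- Membership of `natSite x` in `cellPairSites` is the route's "pair inside" predicate. -/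
theorem natSite_mem_cellPairSites_iff {L ℓ n : ℕ} (x : Fin 4 → Fin (L + 1)) :
    natSite x ∈ cellPairSites ℓ n ↔
      ((∀ k : Fin 4, ((x k : ℕ)) ≤ ℓ) ∧ ((x 1 : ℕ)) + 1 ≤ ℓ ∧ ((x 2 : ℕ)) + 1 ≤ ℓ ∧ ((x 0 : ℕ)) + n ≤ ℓ) := by
  rw [cellPairSites, Finset.mem_filter, mem_halfOpenBox]
  simp only [natSite]
  constructor
  · rintro ⟨h0, h1, h2, h3⟩
    exact ⟨fun k => by have := (h0 k).2; omega, by omega, by omega, by omega⟩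
  · rintro ⟨h0, h1, h2, h3⟩
    exact ⟨fun k => ⟨by positivity, by have := h0 k; omega⟩, by omega, by omega, by omega⟩

omit [IsTopologicalGroup G] [CompactSpace G] [BorelSpace G] in
/-- **The route's source is the `ℤ⁴` source read on the periodic lift**: `cellSource r β m ℓ n L = cellSourceZd r β m ℓ n ∘ torusLift (L+1)`
(`ℓ + 1 ≤ L`). -/
theorem cellSource_eq_cellSourceZd_torusLift (r : LatticeRep G) (β m : ℝ) {ℓ L : ℕ} (hL : ℓ + 1 ≤ L) (n : ℕ)
    (U : GaugeConfig 4 (L + 1) G) :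
    cellSource r β m ℓ n L U = cellSourceZd r β m ℓ n (torusLift (L + 1) U) := by
  classical
  unfold cellSource cellSourceZd
  -- the summand at `x` is the pair density at `natSite x` of the periodic lift
  have hterm : ∀ x : Fin 4 → Fin (L + 1),
      toTorusObservable (L + 1) (fun V => (β * plaqCost0 (d := 4) r.ρ 1 2
        (configShift (fun k => -((x k : ℕ) : ℤ)) V) - m) * (β * plaqCost0 (d := 4) r.ρ 1 2
          (timeShiftLG (G := G) n (configShift (fun k => -((x k : ℕ) : ℤ)) V)) - m)) U =
        pairDensity r β m n (natSite x) (torusLift (L + 1) U) := fun x => rfl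
  simp_rw [hterm]
  rw [← Finset.sum_filter]
  refine Finset.sum_bij' (fun x _ => natSite x)
    (fun z _ => fun k => (⟨(z k).toNat % (L + 1), Nat.mod_lt _ (Nat.succ_pos L)⟩ : Fin (L + 1))) ?_ ?_ ?_ ?_ ?_
  · intro x hx
    exact (natSite_mem_cellPairSites_iff x).2 (Finset.mem_filter.1 hx).2
  · intro z hz
    have hz' := hz
    rw [cellPairSites, Finset.mem_filter, mem_halfOpenBox] at hz'
    obtain ⟨h0, h1, h2, h3⟩ := hz'
    have hlt : ∀ k, (z k).toNat < L + 1 := fun k => by have := h0 k; omega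
    have hmod : ∀ k, (z k).toNat % (L + 1) = (z k).toNat := fun k => Nat.mod_eq_of_lt (hlt k)
    have hcast : ∀ k, (((z k).toNat : ℕ) : ℤ) = z k := fun k => Int.toNat_of_nonneg (h0 k).1
    rw [Finset.mem_filter]
    simp only [Finset.mem_univ, true_and]
    refine ⟨fun k => ?_, ?_, ?_, ?_⟩
    · have := hmod k; have := hcast k; have := h0 k; omega
    · have := hmod 1; have := hcast 1; omega
    · have := hmod 2; have := hcast 2; omega
    · have := hmod 0; have := hcast 0; omega
  · intro x _
    funext k
    apply Fin.ext
    simp only [natSite, Int.toNat_natCast]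
    exact Nat.mod_eq_of_lt (x k).isLt
  · intro z hz
    rw [cellPairSites, Finset.mem_filter, mem_halfOpenBox] at hz
    obtain ⟨h0, -, -, -⟩ := hz
    funext k
    have hk := h0 k
    have hlt : (z k).toNat < L + 1 := by omega
    show (((z k).toNat % (L + 1) : ℕ) : ℤ) = z k
    rw [Nat.mod_eq_of_lt hlt]
    omega
  · intro x _
    rfl

/-- **The mean of the source under the free-cell state is a Chatterjee free-cube expectation**:
`∫ cellSource dν = zdExpect r.ρ β (halfOpenBox 4 (ℓ+1)) (cellSourceZd r β m ℓ n)` (`ℓ + 1 ≤ L`; independent of `L`). -/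
theorem integral_cellSource_freeCellState (r : LatticeRep G) (β m : ℝ) {ℓ L : ℕ} (hL : ℓ + 1 ≤ L) (n : ℕ) :
    ∫ U, cellSource r β m ℓ n L U ∂(freeCellState r β ℓ L) = zdExpect r.ρ β (halfOpenBox 4 (ℓ + 1)) (cellSourceZd r β m ℓ n) := by
  haveI := r.secondCountableTopology
  simp_rw [cellSource_eq_cellSourceZd_torusLift r β m hL n]
  exact integral_comp_torusLift_freeCellState r β hL (continuous_cellSourceZd r β m ℓ n).measurable (dependsOn_cellSourceZd r β m ℓ n)

/-- **The sourced free-cell partition ratio is a Chatterjee free-cube expectation**: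
`∫ e^{−h·cellSource} dν = zdExpect r.ρ β (halfOpenBox 4 (ℓ+1)) (e^{−h·cellSourceZd})` (`ℓ + 1 ≤ L`; independent of `L`). -/
theorem integral_exp_cellSource_freeCellState (r : LatticeRep G) (β m : ℝ) {ℓ L : ℕ} (hL : ℓ + 1 ≤ L) (n : ℕ) (h : ℝ) :
    ∫ U, Real.exp (-h * cellSource r β m ℓ n L U) ∂(freeCellState r β ℓ L) =
      zdExpect r.ρ β (halfOpenBox 4 (ℓ + 1)) (fun V => Real.exp (-h * cellSourceZd r β m ℓ n V)) := by
  haveI := r.secondCountableTopology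
  simp_rw [cellSource_eq_cellSourceZd_torusLift r β m hL n]
  exact integral_comp_torusLift_freeCellState r β hL
    (Real.measurable_exp.comp ((continuous_cellSourceZd r β m ℓ n).measurable.const_mul _))
    (dependsOn_comp (dependsOn_cellSourceZd r β m ℓ n) fun s => Real.exp (-h * s))

end Summit.QuantumFields.YangMills.Cruxes.ColdBoxSourcedPressure.Birth

end
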